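import Summits.QuantumFields.YangMills.Theorems.BalabanUVNodesN18U3TowerGuards
import Literature.MathematicalPhysics.QuantumFieldTheory.Balaban1983to89.Node00.RateRecordW1AllRuns

/-!
# BalabanUVNodes ∕ node N18 = NE5 — NODE U3's BUNDLE OF RECORD AT THE ALL-RUNS OBJECT OF A W1 READING: level-index irrelevance, the `∀ K` dictionary for
# `N18At` ∕ `N22At` ∕ the guard `SensitiveOnBoxes`, and the ALL-RUNS READING at the Stage-13 home (`readingAllRuns₁₃CoPH w1 ℓ₃ ne2 ne1`) — on which the K4 stubs
# `S_N18 ∕ S_N22` SAY EXACTLY what they say at n22-e's per-run-length reading of record, while `S_D4` becomes ONE (D4) sentence per datum key (not one per run length)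

Cell `pub-ymgap`, width seat `pub-ymgap-dag-n18-w2` (HUMAN RULING D-0149 ∕ director-ym №197; plan g77 `W-SEAT-START-LIST` v3 §n18 ITEM 2 «NON-ZERO U3 OBJECT TOWER of
record over the record's boxes»), third module: the Summits-side companion of `Literature/…/Node00/RateRecordW1AllRuns` (the ALL-RUNS packaging
`ReadingData.u3ObjectsAllRuns` of a W1 reading — ONE carrier holding the domains of EVERY run) and of `Theorems/BalabanUVNodesN18U3TowerGuards` (the guard
`SensitiveOnBoxes`; §3 there: (D4) keyed at ONE run length of a run-tower reading degenerates the datum's β above that run length).  `--supports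
stmt-QuantumFields-20544` (K3⁷) AS A HELPER — count-neutral; ONE `def` (the all-runs reading at the ₁₃ home) + kernel bookkeeping BY NAME.

WHAT IS DECLARED ∕ PROVED.
* §1 `u3OfRecord₁₃_allRuns_eq` — the bundle of record of the all-runs object does NOT depend on the run-length index (`rfl`): a run-length selector `ksel` is idle on it;
  faces `_EA ∕ _EB ∕ _C` (`rfl`).
* §2 THE `∀ K` DICTIONARY AT THE BUNDLE (kernel): `n18At_u3OfRecord₁₃_allRuns_of_forall` ∕ `_iff` — `N18At (u3OfRecord₁₃ θ (Dw.u3ObjectsAllRuns γ) k) ↔ ∀ K, N18At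
  (u3OfRecord₁₃ θ (Dw.u3Objects γ) K)` (given a run-B background for every run; the `→`-free half needs none); `n22At_u3OfRecord₁₃_allRuns_of_forall` ∕ `_iff` (run-A
  backgrounds); so node U3's slots at the all-runs object are W1's per-run-length slots AT EVERY RUN LENGTH AT ONCE — nothing lost, nothing added.
* §3 THE GUARD AT THE ALL-RUNS OBJECT: `exists_level_of_sensitiveOnBoxes_allRuns` (no hypothesis) ∕ `sensitiveOnBoxes_allRuns_iff` — the all-runs functional is
  coupling-sensitive over the γ-boxes iff SOME run length's level functional is; `readOutAt_u3OfRecord₁₃_allRuns_iff_zero` ((D4) at the all-runs bundle is level-free).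
* §4 THE ALL-RUNS READING AT THE STAGE-13 HOME `readingAllRuns₁₃CoPH w1 ℓ₃ ne2 ne1 : RateReading₁₃CoPH N` (n22-e's `readingOfRecord₁₃CoPH` with node U3's objects :=
  `(w1 F θ).u3ObjectsAllRuns θ.γ`; the other three components verbatim) + faces; ★ `s_N18_readingAllRuns₁₃CoPH_iff` ∕ `s_N18_readingAllRuns₁₃CoPH_iff_readingOfRecord` (given
  run-B backgrounds: `S_N18` at the all-runs reading ↔ `S_N18` at the reading of record), `s_N22_…` likewise (run-A backgrounds), and ★ `s_D4_readingAllRuns₁₃CoPH_iff` —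
  `S_D4` there is «at every Stage-13 datum key, (D4) for the ONE all-runs bundle» (contrast `U3Guards.boxwiseConstant_of_s_D4_readingOfRecord₁₃CoPH`: at the per-run-length
  reading with run towers `S_D4` is the β-degeneracy sentence).

HONEST FRAMING.  Bookkeeping over W1's RESIDUAL reading data (towers `(w1 F θ).S K` = values of the (2.14) terms, residual; N10's objects not instantiated) and over
typed SHAPES; nothing of Bałaban's is asserted; NE5 ∕ NE9 ∕ (D4) NOT PRINTED for d = 4 beyond [Balaban1987RG1] (1.20)–(1.22)'s linearity and NOT proved; N18 ∕ N22 NOT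
discharged; K3⁷ OPEN, not claimed; counts UNMOVED (typed 28∕28 · discharged 5∕27 (A 5∕28)).  One finite four-torus programme at fixed `ε`, Bałaban as printed; R4 closes the
conditional finite-𝕋⁴ rung `BalabanLadder.UV` only — NOT ℝ⁴, NOT infinite volume, NOT OS, NOT a mass gap, NOT Clay.  No `sorry`, no `instance`, no `notation`.
-/

set_option autoImplicit false

noncomputable section

namespace YMDAG.N18.AllRunsBundle

open Literature.MathematicalPhysics.QuantumFieldTheory.Balaban1983to89
open Literature.MathematicalPhysics.QuantumFieldTheory.Balaban1983to89.T4Continuum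
open Literature.MathematicalPhysics.QuantumFieldTheory.Balaban1983to89.FlowStep (Box)
open Literature.MathematicalPhysics.QuantumFieldTheory.Balaban1983to89.T4FlagMemory (extd)
open Literature.MathematicalPhysics.QuantumFieldTheory.Balaban1983to89.T4OutputRate (Carriers Functional Window NE5 NE9 FadingMemory)
open Literature.MathematicalPhysics.QuantumFieldTheory.Balaban1983to89.Node00 (Stage13Params Stage13HParams IsDatumOfRecord₁₃CCoPH datumOfRecord₁₃CoPH
  U3Objects₁₁ NE3Letters₁₁ NE2Objects₁₁ ne3ConstReadingOfRecord₁₁ MatA)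
open Literature.MathematicalPhysics.QuantumFieldTheory.Balaban1983to89.Node00.W1 (ReadingData)
open YMDAG.UVSplit
open YMDAG.N18.U3Guards (SensitiveOnBoxes)

/-! ## §1 The bundle of record at the all-runs object is level-free -/

section Bundle

variable {F : T4Family} {N : ℕ} [NeZero N] {𝔸 : Type*} {M : ℕ} (θ : Stage13Params F N) (Dw : ReadingData F 𝔸 M) (γ : ℝ)

/-- **THE RUN-LENGTH INDEX IS IDLE ON THE ALL-RUNS OBJECT** (`U3Objects₁₁.ofFixed`: the same carriers and functionals at every level; `rfl`). [folklore] -/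
theorem u3OfRecord₁₃_allRuns_eq (k k' : ℕ) : u3OfRecord₁₃ θ (Dw.u3ObjectsAllRuns γ) k = u3OfRecord₁₃ θ (Dw.u3ObjectsAllRuns γ) k' := rfl

/-- Face: run A's functional of the all-runs bundle IS the all-runs functional (`rfl`). [folklore] -/
theorem u3OfRecord₁₃_allRuns_EA (k : ℕ) : (u3OfRecord₁₃ θ (Dw.u3ObjectsAllRuns γ) k).EA = Dw.allRunsEA := rfl

/-- Face: run B's family of the all-runs bundle IS the all-runs family (`rfl`). [folklore] -/
theorem u3OfRecord₁₃_allRuns_EB (k : ℕ) : (u3OfRecord₁₃ θ (Dw.u3ObjectsAllRuns γ) k).EB = Dw.allRunsEB := rfl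

/-- Face: the carriers of the all-runs bundle ARE the all-runs carriers (`rfl`). [folklore] -/
theorem u3OfRecord₁₃_allRuns_C (k : ℕ) : (u3OfRecord₁₃ θ (Dw.u3ObjectsAllRuns γ) k).C = Dw.allRunsCarriers := rfl

/-! ## §2 The `∀ K` dictionary for `N18At` ∕ `N22At` at the bundle of record -/

/-- **`N18At` AT EVERY RUN-LENGTH LEVEL GIVES `N18At` AT THE ALL-RUNS BUNDLE** (no inhabitant needed; same window `]0,θ.γ]`, same letters). [folklore] -/
theorem n18At_u3OfRecord₁₃_allRuns_of_forall (k : ℕ) (h : ∀ K, N18At (u3OfRecord₁₃ θ (Dw.u3Objects γ) K)) :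
    N18At (u3OfRecord₁₃ θ (Dw.u3ObjectsAllRuns γ) k) :=
  fun b hb hbγ => Dw.ne5_allRuns_of_forall γ fun K => h K b hb hbγ

/-- **★ `N18At` AT THE ALL-RUNS BUNDLE IS `N18At` AT EVERY RUN-LENGTH LEVEL**, given a run-B background for every run (gauge-field types at the record: inhabited). [folklore] -/
theorem n18At_u3OfRecord₁₃_allRuns_iff (hB : ∀ K, Nonempty (Dw.pairing K).BgB) (k : ℕ) :
    N18At (u3OfRecord₁₃ θ (Dw.u3ObjectsAllRuns γ) k) ↔ ∀ K, N18At (u3OfRecord₁₃ θ (Dw.u3Objects γ) K) :=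
  ⟨fun h K b hb hbγ => (Dw.ne5_allRuns_iff γ hB b _ _ _ _).mp (h b hb hbγ) K, n18At_u3OfRecord₁₃_allRuns_of_forall θ Dw γ k⟩

/-- **`N22At` AT EVERY RUN-LENGTH LEVEL GIVES `N22At` AT THE ALL-RUNS BUNDLE** (the fading-memory half is the letter clause, identical at every level). [folklore] -/
theorem n22At_u3OfRecord₁₃_allRuns_of_forall (k : ℕ) (h : ∀ K, N22At (u3OfRecord₁₃ θ (Dw.u3Objects γ) K)) :
    N22At (u3OfRecord₁₃ θ (Dw.u3ObjectsAllRuns γ) k) :=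
  ⟨Dw.ne9_allRuns_of_forall γ fun K => (h K).1, (h 0).2⟩

/-- **★ `N22At` AT THE ALL-RUNS BUNDLE IS `N22At` AT EVERY RUN-LENGTH LEVEL**, given a run-A background for every run. [folklore] -/
theorem n22At_u3OfRecord₁₃_allRuns_iff (hA : ∀ K, Nonempty (Dw.pairing K).BgA) (k : ℕ) :
    N22At (u3OfRecord₁₃ θ (Dw.u3ObjectsAllRuns γ) k) ↔ ∀ K, N22At (u3OfRecord₁₃ θ (Dw.u3Objects γ) K) :=
  ⟨fun h K => ⟨(Dw.ne9_allRuns_iff γ hA _ _ _).mp h.1 K, h.2⟩, n22At_u3OfRecord₁₃_allRuns_of_forall θ Dw γ k⟩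

/-! ## §3 The guard and (D4) at the all-runs object -/

/-- **IF THE ALL-RUNS FUNCTIONAL PASSES THE GUARD, SOME RUN-LENGTH LEVEL DOES** (no hypothesis): the differing slices differ at some domain `⟨K, X⟩` and background `U`,
hence the level-`K` slices differ at `U K`. [folklore] -/
theorem exists_level_of_sensitiveOnBoxes_allRuns {γb : ℝ} (h : SensitiveOnBoxes Dw.allRunsEA γb) : ∃ K, SensitiveOnBoxes ((Dw.u3Objects γ).EA K) γb := by
  obtain ⟨k, v, v', hv, hv', hne⟩ := h
  obtain ⟨U, hU⟩ := Function.ne_iff.mp hne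
  obtain ⟨⟨K, X⟩, hX⟩ := Function.ne_iff.mp hU
  exact ⟨K, k, v, v', hv, hv', Function.ne_iff.mpr ⟨U K, Function.ne_iff.mpr ⟨X, hX⟩⟩⟩

/-- **★ THE ALL-RUNS FUNCTIONAL PASSES THE GUARD IFF SOME RUN-LENGTH LEVEL DOES**, given a run-A background for every run (to extend one component). [folklore] -/
theorem sensitiveOnBoxes_allRuns_iff (hA : ∀ K, Nonempty (Dw.pairing K).BgA) (γb : ℝ) :
    SensitiveOnBoxes Dw.allRunsEA γb ↔ ∃ K, SensitiveOnBoxes ((Dw.u3Objects γ).EA K) γb := by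
  classical
  refine ⟨exists_level_of_sensitiveOnBoxes_allRuns Dw γ, ?_⟩
  rintro ⟨K, k, v, v', hv, hv', hne⟩
  obtain ⟨UK, hU⟩ := Function.ne_iff.mp hne
  obtain ⟨X, hX⟩ := Function.ne_iff.mp hU
  refine ⟨k, v, v', hv, hv', Function.ne_iff.mpr ⟨Function.update (fun K' => Classical.choice (hA K')) K UK, Function.ne_iff.mpr ⟨⟨K, X⟩, ?_⟩⟩⟩
  intro hEq
  apply hX
  have h1 := Dw.allRunsEA_apply γ (extd v) (Function.update (fun K' => Classical.choice (hA K')) K UK) K X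
  have h2 := Dw.allRunsEA_apply γ (extd v') (Function.update (fun K' => Classical.choice (hA K')) K UK) K X
  rw [Function.update_self] at h1 h2
  rw [← h1, ← h2]
  exact hEq

variable {θ Dw γ} in
/-- **(D4) AT THE ALL-RUNS BUNDLE IS LEVEL-FREE**: `ReadOutAt D (… k) ↔ ReadOutAt D (… 0)` — the v2 draft's run-length selector is idle here (contrast: at a run-tower
reading's level `k` it decides which couplings β may depend on, `U3Guards.beta_eq_of_readOutAt_runLevel`). [folklore] -/
theorem readOutAt_u3OfRecord₁₃_allRuns_iff_zero (D : Datum F N) (k : ℕ) :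
    ReadOutAt D (u3OfRecord₁₃ θ (Dw.u3ObjectsAllRuns γ) k) ↔ ReadOutAt D (u3OfRecord₁₃ θ (Dw.u3ObjectsAllRuns γ) 0) := by
  rw [u3OfRecord₁₃_allRuns_eq θ Dw γ k 0]

end Bundle

/-! ## §4 The all-runs reading at the Stage-13 home and what the K4 stubs say there -/

section Home

variable {N : ℕ} [NeZero N]

/-- **THE ALL-RUNS READING AT STAGE 13**: n22-e's reading of record `readingOfRecord₁₃CoPH w1 ℓ₃ ne2 ne1` with node U3's objects := the ALL-RUNS object of W1's reading data at
window radius `θ.γ` (`(w1 F θ).u3ObjectsAllRuns θ.γ`); N16's layer := RR-1's constant reading of record, N15's layer and NODE O's dressed tower residual — verbatim as there. [folklore] -/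
@[folklore]
def readingAllRuns₁₃CoPH (w1 : (F : T4Family) → (θ : Stage13HParams F N) → ReadingData F (MatA N) θ.τ9.M) (ℓ₃ : T4Family → NE3Letters₁₁)
    (ne2 : (F : T4Family) → Stage13HParams F N → (ℕ → ℝ) → List (ULoop F) → ℕ → NE2Objects₁₁)
    (ne1 : (F : T4Family) → Stage13HParams F N → (ℕ → ℝ) → List (ULoop F) → NE1pCarriers) : RateReading₁₃CoPH N :=
  ⟨fun F θ _ g₀ os => ⟨(w1 F θ).u3ObjectsAllRuns θ.γ, ne3ConstReadingOfRecord₁₁ F N (ℓ₃ F), ne2 F θ g₀ os⟩, fun F θ _ g₀ os => ne1 F θ g₀ os⟩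

variable (w1 : (F : T4Family) → (θ : Stage13HParams F N) → ReadingData F (MatA N) θ.τ9.M) (ℓ₃ : T4Family → NE3Letters₁₁)
  (ne2 : (F : T4Family) → Stage13HParams F N → (ℕ → ℝ) → List (ULoop F) → ℕ → NE2Objects₁₁)
  (ne1 : (F : T4Family) → Stage13HParams F N → (ℕ → ℝ) → List (ULoop F) → NE1pCarriers)

/-- Face: node U3's objects of the all-runs reading (`rfl`). [folklore] -/
theorem readingAllRuns₁₃CoPH_u3 (F : T4Family) (θ : Stage13HParams F N) (hP : θ.Provisos₁₃CoPH F N) (g₀ : ℕ → ℝ) (os : List (ULoop F)) :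
    ((readingAllRuns₁₃CoPH w1 ℓ₃ ne2 ne1).lit F θ hP g₀ os).u3 = (w1 F θ).u3ObjectsAllRuns θ.γ := rfl

/-- Face: the other three components are those of the reading of record (`rfl` ×3 packaged: the readings differ in the U3 component only). [folklore] -/
theorem readingAllRuns₁₃CoPH_ne3_ne2_ne1 (F : T4Family) (θ : Stage13HParams F N) (hP : θ.Provisos₁₃CoPH F N) (g₀ : ℕ → ℝ) (os : List (ULoop F)) :
    ((readingAllRuns₁₃CoPH w1 ℓ₃ ne2 ne1).lit F θ hP g₀ os).ne3 = ((readingOfRecord₁₃CoPH w1 ℓ₃ ne2 ne1).lit F θ hP g₀ os).ne3 ∧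
      ((readingAllRuns₁₃CoPH w1 ℓ₃ ne2 ne1).lit F θ hP g₀ os).ne2 = ((readingOfRecord₁₃CoPH w1 ℓ₃ ne2 ne1).lit F θ hP g₀ os).ne2 ∧
        (readingAllRuns₁₃CoPH w1 ℓ₃ ne2 ne1).ne1 F θ hP g₀ os = (readingOfRecord₁₃CoPH w1 ℓ₃ ne2 ne1).ne1 F θ hP g₀ os :=
  ⟨rfl, rfl, rfl⟩

/-- Face: the U3 component of EVERY run-length bundle of the all-runs reading is the ONE all-runs bundle (`rfl`, level `0` as representative). [folklore] -/
theorem readingAllRuns₁₃CoPH_bundle_u3 (F : T4Family) (θ : Stage13HParams F N) (hP : θ.Provisos₁₃CoPH F N) (g₀ : ℕ → ℝ) (os : List (ULoop F)) (k : ℕ) :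
    (rateCarriersOfRecord₁₃CoPH (readingAllRuns₁₃CoPH w1 ℓ₃ ne2 ne1) F θ hP g₀ os k).u3 = u3OfRecord₁₃ θ.toStage13Params ((w1 F θ).u3ObjectsAllRuns θ.γ) 0 := rfl

/-- **`S_N18` AT THE ALL-RUNS READING, CLOSED FORM**: «at every Stage-13 datum key, `N18At` for the ONE all-runs bundle at the canonical parameter» (`g₀`, `os`, `k` idle). [folklore] -/
theorem s_N18_readingAllRuns₁₃CoPH_iff :
    S_N18 (RRec₁₃CoPH (readingAllRuns₁₃CoPH w1 ℓ₃ ne2 ne1)) ↔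
      ∀ (F : T4Family) (D : Datum F N) (h : IsDatumOfRecord₁₃CCoPH F N D),
        N18At (u3OfRecord₁₃ h.params.toStage13Params ((w1 F h.params).u3ObjectsAllRuns h.params.γ) 0) := by
  rw [s_N18_rRec₁₃CoPH_iff]
  exact ⟨fun H F D h => H F D h (fun _ => 0) [] 0, fun H F D h _ _ _ => H F D h⟩

/-- **★ `S_N18` AT THE ALL-RUNS READING IS `S_N18` AT THE READING OF RECORD** (given a run-B background for every run of every reading datum): NE5 at every datum key for
every run length's level of W1's reading — node U3's N18 content is UNCHANGED by the re-packaging. [folklore] -/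
theorem s_N18_readingAllRuns₁₃CoPH_iff_readingOfRecord (hB : ∀ (F : T4Family) (θ : Stage13HParams F N) (K : ℕ), Nonempty ((w1 F θ).pairing K).BgB) :
    S_N18 (RRec₁₃CoPH (readingAllRuns₁₃CoPH w1 ℓ₃ ne2 ne1)) ↔ S_N18 (RRec₁₃CoPH (readingOfRecord₁₃CoPH w1 ℓ₃ ne2 ne1)) := by
  rw [s_N18_readingAllRuns₁₃CoPH_iff, s_N18_readingOfRecord₁₃CoPH_iff]
  refine ⟨fun H F D h k => ?_, fun H F D h => ?_⟩
  · exact (n18At_u3OfRecord₁₃_allRuns_iff h.params.toStage13Params (w1 F h.params) h.params.γ (hB F h.params) 0).mp (H F D h) k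
  · exact n18At_u3OfRecord₁₃_allRuns_of_forall h.params.toStage13Params (w1 F h.params) h.params.γ 0 fun K => H F D h K

/-- **`S_N22` AT THE ALL-RUNS READING, CLOSED FORM.** [folklore] -/
theorem s_N22_readingAllRuns₁₃CoPH_iff :
    S_N22 (RRec₁₃CoPH (readingAllRuns₁₃CoPH w1 ℓ₃ ne2 ne1)) ↔
      ∀ (F : T4Family) (D : Datum F N) (h : IsDatumOfRecord₁₃CCoPH F N D),
        N22At (u3OfRecord₁₃ h.params.toStage13Params ((w1 F h.params).u3ObjectsAllRuns h.params.γ) 0) := by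
  rw [s_N22_rRec₁₃CoPH_iff]
  exact ⟨fun H F D h => H F D h (fun _ => 0) [] 0, fun H F D h _ _ _ => H F D h⟩

/-- **★ `S_N22` AT THE ALL-RUNS READING IS `S_N22` AT THE READING OF RECORD** (given a run-A background for every run). [folklore] -/
theorem s_N22_readingAllRuns₁₃CoPH_iff_readingOfRecord (hA : ∀ (F : T4Family) (θ : Stage13HParams F N) (K : ℕ), Nonempty ((w1 F θ).pairing K).BgA) :
    S_N22 (RRec₁₃CoPH (readingAllRuns₁₃CoPH w1 ℓ₃ ne2 ne1)) ↔ S_N22 (RRec₁₃CoPH (readingOfRecord₁₃CoPH w1 ℓ₃ ne2 ne1)) := by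
  rw [s_N22_readingAllRuns₁₃CoPH_iff, s_N22_readingOfRecord₁₃CoPH_iff]
  refine ⟨fun H F D h k => ?_, fun H F D h => ?_⟩
  · exact (n22At_u3OfRecord₁₃_allRuns_iff h.params.toStage13Params (w1 F h.params) h.params.γ (hA F h.params) 0).mp (H F D h) k
  · exact n22At_u3OfRecord₁₃_allRuns_of_forall h.params.toStage13Params (w1 F h.params) h.params.γ 0 fun K => H F D h K

/-- **★ `S_D4` AT THE ALL-RUNS READING IS ONE (D4) SENTENCE PER DATUM KEY** — (D4) for the ONE all-runs bundle at the canonical parameter — not one per run length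
(contrast `U3Guards.boxwiseConstant_of_s_D4_readingOfRecord₁₃CoPH`: at the per-run-length reading with run towers `S_D4` pins the termless level `0` and degenerates β). [folklore] -/
theorem s_D4_readingAllRuns₁₃CoPH_iff :
    S_D4 (RRec₁₃CoPH (readingAllRuns₁₃CoPH w1 ℓ₃ ne2 ne1)) ↔
      ∀ (F : T4Family) (D : Datum F N) (h : IsDatumOfRecord₁₃CCoPH F N D),
        ReadOutAt D (u3OfRecord₁₃ h.params.toStage13Params ((w1 F h.params).u3ObjectsAllRuns h.params.γ) 0) := by
  rw [s_D4_rRec₁₃CoPH_iff]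
  exact ⟨fun H F D h => H F D h (fun _ => 0) [] 0, fun H F D h _ _ _ => H F D h⟩

/-- **UNDER `S_D4` AT THE ALL-RUNS READING, THE GUARD FOLLOWS FROM β-NONDEGENERACY** (U3Guards §2 at this home): at a datum key whose β is NOT boxwise constant on
`]0, γ]`-boxes, the all-runs functional of record is coupling-sensitive — hence (no hypothesis) SOME run length's level functional is. [folklore] -/
theorem exists_level_sensitiveOnBoxes_of_s_D4_readingAllRuns (hD4 : S_D4 (RRec₁₃CoPH (readingAllRuns₁₃CoPH w1 ℓ₃ ne2 ne1)))
    (F : T4Family) (D : Datum F N) (h : IsDatumOfRecord₁₃CCoPH F N D) (hβ : ¬ U3Guards.BoxwiseConstant h.params.γ D.βfun) :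
    ∃ K, SensitiveOnBoxes (((w1 F h.params).u3Objects h.params.γ).EA K) h.params.γ :=
  exists_level_of_sensitiveOnBoxes_allRuns (w1 F h.params) h.params.γ
    (U3Guards.sensitiveOnBoxes_of_readOutAt ((s_D4_readingAllRuns₁₃CoPH_iff w1 ℓ₃ ne2 ne1).mp hD4 F D h) hβ)

end Home

end YMDAG.N18.AllRunsBundle

end
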